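import Summits.AtomisticToContinuum.BoseEinsteinCondensation.Theses.BECConjugateDomination
import Summits.AtomisticToContinuum.BoseEinsteinCondensation.Theorems.BECConjugateDominationInfraredMinimumUncertaintyFSum
import Summits.AtomisticToContinuum.BoseEinsteinCondensation.Theorems.BECConjugateDominationInfraredMinimumUncertaintySteinForm
import Summits.AtomisticToContinuum.BoseEinsteinCondensation.Theorems.BECConjugateDominationInfraredMinimumUncertaintyWeakEulerLagrange
import Literature.MathematicalPhysics.QuantumManyBody.PeriodicTorusCalculus
import Literature.MathematicalPhysics.QuantumManyBody.PeriodizedPotentialNearestImage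
import Literature.MathematicalPhysics.QuantumManyBody.OneBodyCurrentGain

/-!
# Route `BECConjugateDomination`, crux `PuffFloor` (stmt-AtomisticToContinuum-11785),
# line `coupling-slope-pocket`, stub S4b (Puff–Feynman floor): preparation of the data

Supports (does not close) stmt-AtomisticToContinuum-11785. Book-keeping for the sum-rule engine
`stub_puffFeynmanFloor`: the hypotheses of the stub (a real, nowhere-vanishing, `C³` exact minimiser
`Ψ` of the periodic `(n+1)`-body energy satisfying the eigenvalue equation pointwise, and Puff's
parameter bound `12T + 2P ≤ ΘN`) are converted to the real-valued calculus data used by the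
Literature files `PuffCubicMoment*.lean` / `PeriodicTorus*.lean`:

* the real amplitude `u = Re Ψ` (`Ψ = u`): `C³`, lattice periodic, Bose symmetric; its first and
  second derivatives and the **real form of the eigenvalue equation** `-Δu + Vu = E₀u`
  (`V = (∑_{i<j} v^per(xᵢ-xⱼ)).toReal`, `E₀ = (E₀^per).toReal`);
* the **f-sum rule in real form** `Re ∫ conj(ρ_k u) A = (n+1)‖k‖²`, `A = ∑ⱼ eⱼ(‖k‖²u - 2i∂ⱼu)`
  (from the landed `fSumIdentity_holds`);
* normalisation `∫u² = 1`, the kinetic energy `T` and the Puff pair functional `P` as real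
  integrals, the directional bound `∑ⱼ(∂_{xⱼ·k}u)² ≤ ‖k‖²|∇u|²`, and `12T + 2P ≤ Θ(n+1)` in `ℝ`;
* admissibility (smooth, periodic, symmetric) of the test amplitudes `ρ_k u` and `A`, and the
  variational non-negativity of the shifted form `∫ (|∇ψ|² + (V - E₀)|ψ|²) ≥ 0` on the Bose class.

References: Puff 1965; Stringari 1995 §2.3; Reed–Simon IV §XIII.1.
-/

noncomputable section

namespace Summit.AtomisticToContinuum.BoseEinsteinCondensation.Theorems

open MeasureTheory Filter
open scoped ENNReal NNReal BigOperators ComplexConjugate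
open Literature.MathematicalPhysics.QuantumManyBody.BoseGas
open Summit.AtomisticToContinuum.BoseEinsteinCondensation.Theses.BECConjugateDomination
open Summit.AtomisticToContinuum.BoseEinsteinCondensation.Cruxes.InfraredMinimumUncertainty.FisherGaussianDensityMode

namespace PuffFeynmanFloor

variable {n : ℕ} {L : ℝ}

/-! ## The real amplitude -/

section RealAmplitude

variable (Ψ : PeriodicTrialState (n + 1) L)

/-- A `C³` state has a `C³` real amplitude. [folklore] -/
theorem contDiff_three_realAmp (hC3 : ContDiff ℝ 3 Ψ.ψ) : ContDiff ℝ 3 fun X => (Ψ.ψ X).re :=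
  Complex.reCLM.contDiff.comp hC3

/-- The real amplitude is Bose symmetric. [folklore] -/
theorem realAmp_symm (σ : Equiv.Perm (Fin (n + 1))) (X : Config (n + 1)) :
    (Ψ.ψ (X ∘ σ)).re = (Ψ.ψ X).re := by rw [Ψ.symm σ X]

/-- The kinetic energy as a real integral: `(∫⁻ |∇Ψ|²).toReal = ∫ |∇Ψ|²`. [folklore] -/
theorem toReal_lintegral_kineticDensity :
    (∫⁻ X in cellN (n + 1) L, kineticDensity Ψ.ψ X).toReal = ∫ X in cellN (n + 1) L, kineticDensityReal Ψ.ψ X := by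
  rw [lintegral_kineticDensity_eq Ψ.contDiff, cellKineticEnergy,
    ENNReal.toReal_ofReal (integral_nonneg fun X => kineticDensityReal_nonneg _ X)]

variable (hreal : ∀ X, Ψ.ψ X = (‖Ψ.ψ X‖ : ℂ))
include hreal

/-- `Ψ = Re Ψ` as functions, for a real-valued state. [folklore] -/
theorem psi_eq_ofReal_realAmp : Ψ.ψ = fun X => (((Ψ.ψ X).re : ℝ) : ℂ) :=
  funext (realAmp_eq Ψ hreal)

/-- `|Ψ| = |u|` pointwise: `‖Ψ X‖ = ‖(u X : ℂ)‖`. [folklore] -/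
theorem norm_psi_eq (X : Config (n + 1)) : ‖Ψ.ψ X‖ = ‖(((Ψ.ψ X).re : ℝ) : ℂ)‖ := by
  conv_lhs => rw [realAmp_eq Ψ hreal X]

/-- `conj Ψ = u` pointwise for a real state. [folklore] -/
theorem conj_psi_eq (X : Config (n + 1)) : conj (Ψ.ψ X) = (((Ψ.ψ X).re : ℝ) : ℂ) := by
  conv_lhs => rw [realAmp_eq Ψ hreal X]
  exact Complex.conj_ofReal _

/-- Second derivatives of a real `C³` state are the second derivatives of its real amplitude.
[folklore] -/
theorem fderiv_fderiv_psi (hC3 : ContDiff ℝ 3 Ψ.ψ) (X v w : Config (n + 1)) :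
    fderiv ℝ (fun Y => fderiv ℝ Ψ.ψ Y v) X w =
      ((fderiv ℝ (fun Y => fderiv ℝ (fun Z => (Ψ.ψ Z).re) Y v) X w : ℝ) : ℂ) := by
  have hu := contDiff_three_realAmp Ψ hC3
  have hu2 : ContDiff ℝ 2 fun X => (Ψ.ψ X).re := hu.of_le (by norm_num)
  have h1 : (fun Y => fderiv ℝ Ψ.ψ Y v) = fun Y => ((fderiv ℝ (fun Z => (Ψ.ψ Z).re) Y v : ℝ) : ℂ) :=
    funext fun Y => fderiv_realAmp Ψ hreal Y v
  rw [h1, fderiv_ofReal_apply (differentiable_fderiv_apply_const hu2 v X)]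

/-- **The eigenvalue equation in real form.** If `-ΔΨ + V^perΨ = E₀Ψ` pointwise (complex form of the
stub) for a real `C³` state, then `u = Re Ψ` satisfies `-Δu + V u = E₀ u` with
`V = (V^per).toReal`, `E₀ = (E₀^per).toReal`. [folklore] -/
theorem realEquation (hC3 : ContDiff ℝ 3 Ψ.ψ) {v : ℝ → ℝ≥0∞}
    (hEL : ∀ X : Config (n + 1),
      -(∑ i : Fin (n + 1), ∑ a : Fin 3,
          fderiv ℝ (fun Y : Config (n + 1) =>
              fderiv ℝ Ψ.ψ Y (Pi.single i (EuclideanSpace.single a (1 : ℝ)))) X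
            (Pi.single i (EuclideanSpace.single a (1 : ℝ)))) +
        ((periodicInteraction v L X).toReal : ℂ) * Ψ.ψ X =
      ((periodicGroundStateEnergy v (n + 1) L).toReal : ℂ) * Ψ.ψ X) (X : Config (n + 1)) :
    -(∑ i : Fin (n + 1), ∑ a : Fin 3,
        fderiv ℝ (fun Y : Config (n + 1) => fderiv ℝ (fun Z => (Ψ.ψ Z).re) Y
          (Pi.single i (EuclideanSpace.single a (1 : ℝ)))) X (Pi.single i (EuclideanSpace.single a (1 : ℝ)))) +
      (periodicInteraction v L X).toReal * (Ψ.ψ X).re =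
    (periodicGroundStateEnergy v (n + 1) L).toReal * (Ψ.ψ X).re := by
  have h := hEL X
  simp_rw [fderiv_fderiv_psi Ψ hreal hC3] at h
  rw [realAmp_eq Ψ hreal X] at h
  exact_mod_cast h

/-- Normalisation in real form: `∫ u² = 1`. [folklore] -/
theorem integral_realAmp_sq : ∫ X in cellN (n + 1) L, (Ψ.ψ X).re ^ 2 = 1 := by
  have h := ImuWeakEulerLagrange.lintegral_nnnorm_sq_eq_ofReal Ψ.contDiff.continuous L
  rw [Ψ.norm_eq] at h
  have h1 : ∫ X in cellN (n + 1) L, ‖Ψ.ψ X‖ ^ 2 = 1 := by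
    have hnn : 0 ≤ ∫ X in cellN (n + 1) L, ‖Ψ.ψ X‖ ^ 2 := integral_nonneg fun X => sq_nonneg _
    have := congrArg ENNReal.toReal h
    rwa [ENNReal.toReal_ofReal hnn, ENNReal.toReal_one, eq_comm] at this
  rw [← h1]
  exact integral_congr_ae (ae_of_all _ fun X => (norm_sq_realAmp Ψ hreal X).symm)

/-- The kinetic density of a real state in terms of its real amplitude:
`|∇Ψ|² = ∑_{i,a} (∂_{i,a}u)²`. [folklore] -/
theorem kineticDensityReal_psi (X : Config (n + 1)) :
    kineticDensityReal Ψ.ψ X = ∑ i : Fin (n + 1), ∑ a : Fin 3,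
      fderiv ℝ (fun Z => (Ψ.ψ Z).re) X (Pi.single i (EuclideanSpace.single a (1 : ℝ))) ^ 2 := by
  unfold kineticDensityReal
  refine Finset.sum_congr rfl fun i _ => Finset.sum_congr rfl fun a _ => ?_
  rw [fderiv_realAmp Ψ hreal, Complex.norm_real, Real.norm_eq_abs, sq_abs]

/-- **Directional kinetic bound**: `∑ⱼ (∂_{xⱼ·w}u)² ≤ ‖w‖² |∇Ψ|²` pointwise (Cauchy–Schwarz in `ℝ³`).
[folklore] -/
theorem sum_sq_fderiv_single_le (X : Config (n + 1)) (w : Space) :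
    ∑ j : Fin (n + 1), fderiv ℝ (fun Z => (Ψ.ψ Z).re) X (Pi.single j w) ^ 2 ≤
      ‖w‖ ^ 2 * kineticDensityReal Ψ.ψ X := by
  rw [kineticDensityReal_psi Ψ hreal, Finset.mul_sum]
  refine Finset.sum_le_sum fun j _ => ?_
  rw [fderiv_apply_single_eq_sum, EuclideanSpace.real_norm_sq_eq]
  simp only [smul_eq_mul]
  exact Finset.sum_mul_sq_le_sq_mul_sq Finset.univ (fun c => w c)
    (fun c => fderiv ℝ (fun Z => (Ψ.ψ Z).re) X (Pi.single j (EuclideanSpace.single c (1 : ℝ))))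

end RealAmplitude

/-! ## The f-sum rule in real form -/

/-- **The f-sum rule for a real state, in the form used by the Puff engine**:
`Re ∫ conj(ρ_k Ψ) A = (n+1)‖k‖²` with `ρ_k = ∑ⱼ eⱼ`, `A = ∑ⱼ eⱼ(‖k‖²u - 2i ∂_{xⱼ·k}u)`, `u = Re Ψ`,
`k = 2πm/L` (the landed `fSumIdentity_holds`, rewritten for the real amplitude). [folklore] -/
theorem fsum_real (hL : 0 < L) (Ψ : PeriodicTrialState (n + 1) L) (hreal : ∀ X, Ψ.ψ X = (‖Ψ.ψ X‖ : ℂ))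
    (m : Fin 3 → ℤ) :
    (∫ X in cellN (n + 1) L, conj ((∑ j : Fin (n + 1), cellWave L m (X j)) * (((Ψ.ψ X).re : ℝ) : ℂ)) *
      ∑ j : Fin (n + 1), cellWave L m (X j) *
        ((((‖(2 * Real.pi / L) • latticeVec 1 m‖ ^ 2 : ℝ) : ℂ)) * (((Ψ.ψ X).re : ℝ) : ℂ) -
          2 * Complex.I * ((fderiv ℝ (fun Z => (Ψ.ψ Z).re) X
            (Pi.single j ((2 * Real.pi / L) • latticeVec 1 m)) : ℝ) : ℂ))).re =
      ((n : ℝ) + 1) * ‖(2 * Real.pi / L) • latticeVec 1 m‖ ^ 2 := by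
  have hk : waveVec L m = (2 * Real.pi / L) • latticeVec 1 m := rfl
  rw [← hk, ← fSumIdentity_holds n L hL Ψ hreal m]
  have hint : Integrable (fun X => conj ((∑ j : Fin (n + 1), cellWave L m (X j)) * (((Ψ.ψ X).re : ℝ) : ℂ)) *
      ∑ j : Fin (n + 1), cellWave L m (X j) *
        ((((‖waveVec L m‖ ^ 2 : ℝ) : ℂ)) * (((Ψ.ψ X).re : ℝ) : ℂ) -
          2 * Complex.I * ((fderiv ℝ (fun Z => (Ψ.ψ Z).re) X (Pi.single j (waveVec L m)) : ℝ) : ℂ)))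
      (volume.restrict (cellN (n + 1) L)) := by
    have hZ := continuous_densityMode (n + 1) L m
    have hu : Continuous fun X => (((Ψ.ψ X).re : ℝ) : ℂ) :=
      Complex.continuous_ofReal.comp (contDiff_realAmp Ψ).continuous
    refine integrableOn_cellN ((Complex.continuous_conj.comp (hZ.mul hu)).mul
      (continuous_finsetSum _ fun j _ => ?_)) L
    have he := (contDiff_cellWave L m).continuous.comp (continuous_apply (A := fun _ : Fin (n + 1) => Space) j)
    have hd : Continuous fun X => ((fderiv ℝ (fun Z => (Ψ.ψ Z).re) X (Pi.single j (waveVec L m)) : ℝ) : ℂ) :=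
      Complex.continuous_ofReal.comp (continuous_fderiv_apply_const (contDiff_realAmp Ψ) _)
    fun_prop
  rw [← Complex.reCLM_apply (∫ X in cellN (n + 1) L, _), ← ContinuousLinearMap.integral_comp_comm _ hint]
  refine integral_congr_ae (ae_of_all _ fun X => ?_)
  simp only [Complex.reCLM_apply]
  have hW : commutatorAmp (n + 1) L Ψ.ψ m X = ∑ j : Fin (n + 1), cellWave L m (X j) *
      ((((‖waveVec L m‖ ^ 2 : ℝ) : ℂ)) * (((Ψ.ψ X).re : ℝ) : ℂ) -
        2 * Complex.I * ((fderiv ℝ (fun Z => (Ψ.ψ Z).re) X (Pi.single j (waveVec L m)) : ℝ) : ℂ)) := by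
    unfold commutatorAmp
    refine Finset.sum_congr rfl fun j _ => ?_
    rw [fderiv_realAmp Ψ hreal, ← realAmp_eq Ψ hreal X]
  rw [hW, conj_psi_eq Ψ hreal X]
  unfold densityMode
  rw [map_mul, Complex.conj_ofReal]
  congr 1
  ring

/-! ## The Puff pair functional and Puff's parameter in real form -/

section PairFunctional

variable (Ψ : PeriodicTrialState (n + 1) L) (hreal : ∀ X, Ψ.ψ X = (‖Ψ.ψ X‖ : ℂ))

include hreal in
/-- `‖Ψ‖₊² = ofReal (u²)` pointwise for a real state. [folklore] -/
theorem coe_nnnorm_sq_psi (X : Config (n + 1)) :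
    ((‖Ψ.ψ X‖₊ : ℝ≥0∞)) ^ 2 = ENNReal.ofReal ((Ψ.ψ X).re ^ 2) := by
  rw [coe_nnnorm_sq_eq_ofReal, norm_sq_realAmp Ψ hreal X]

include hreal in
/-- **The pair functional as a real integral.** For a measurable profile `W` whose periodic
interaction is finite everywhere, if `P = ∫⁻ (∑W^per)|Ψ|² < ∞` then `X ↦ (∑W^per)(X).toReal u(X)²`
is integrable on the cell and its integral is `P.toReal`. [folklore] -/
theorem pairFunctional_real {W : ℝ → ℝ≥0∞} (hWm : Measurable W)
    (hWfin : ∀ X : Config (n + 1), periodicInteraction W L X ≠ ⊤)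
    (hP : (∫⁻ X in cellN (n + 1) L, periodicInteraction W L X * ((‖Ψ.ψ X‖₊ : ℝ≥0∞)) ^ 2) ≠ ⊤) :
    Integrable (fun X => (periodicInteraction W L X).toReal * (Ψ.ψ X).re ^ 2)
        (volume.restrict (cellN (n + 1) L)) ∧
      ∫ X in cellN (n + 1) L, (periodicInteraction W L X).toReal * (Ψ.ψ X).re ^ 2 =
        (∫⁻ X in cellN (n + 1) L, periodicInteraction W L X * ((‖Ψ.ψ X‖₊ : ℝ≥0∞)) ^ 2).toReal := by
  set f : Config (n + 1) → ℝ≥0∞ := fun X => periodicInteraction W L X * ENNReal.ofReal ((Ψ.ψ X).re ^ 2)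
    with hf
  have hu : Continuous fun X => (Ψ.ψ X).re ^ 2 := (contDiff_realAmp Ψ).continuous.pow 2
  have hfm : Measurable f :=
    (measurable_periodicInteraction hWm L).mul (ENNReal.measurable_ofReal.comp hu.measurable)
  have hfeq : ∀ X, periodicInteraction W L X * ((‖Ψ.ψ X‖₊ : ℝ≥0∞)) ^ 2 = f X := fun X => by
    simp only [hf, coe_nnnorm_sq_psi Ψ hreal X]
  have hft : ∀ X, (f X).toReal = (periodicInteraction W L X).toReal * (Ψ.ψ X).re ^ 2 := fun X => by
    rw [hf, ENNReal.toReal_mul, ENNReal.toReal_ofReal (sq_nonneg _)]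
  have hflt : ∀ X, f X < ⊤ := fun X =>
    ENNReal.mul_lt_top (lt_top_iff_ne_top.2 (hWfin X)) ENNReal.ofReal_lt_top
  simp_rw [hfeq] at hP ⊢
  simp_rw [← hft]
  refine ⟨?_, integral_toReal hfm.aemeasurable (ae_of_all _ hflt)⟩
  refine ⟨hfm.ennreal_toReal.aestronglyMeasurable, ?_⟩
  rw [hasFiniteIntegral_iff_enorm]
  calc (∫⁻ X in cellN (n + 1) L, ‖(f X).toReal‖ₑ) = ∫⁻ X in cellN (n + 1) L, f X := by
        refine lintegral_congr fun X => ?_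
        rw [Real.enorm_eq_ofReal ENNReal.toReal_nonneg, ENNReal.ofReal_toReal (hflt X).ne]
    _ < ⊤ := lt_top_iff_ne_top.2 hP

/-- **Puff's parameter in real form.** From `12·T + 2·P ≤ Θ(n+1)` in `ℝ≥0∞` (`T` the kinetic energy,
`P` the Puff pair functional, both as lower Lebesgue integrals) one gets finiteness of `P` and the
real inequality `12 ∫|∇Ψ|² + 2 P.toReal ≤ Θ(n+1)`. [folklore] -/
theorem puffParameter_real {W : ℝ → ℝ≥0∞} {Θ : ℝ} (hΘ : 0 ≤ Θ)
    (hT : (∫⁻ X in cellN (n + 1) L, kineticDensity Ψ.ψ X) ≠ ⊤)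
    (h : ENNReal.ofReal 12 * (∫⁻ X in cellN (n + 1) L, kineticDensity Ψ.ψ X) +
        ENNReal.ofReal 2 * (∫⁻ X in cellN (n + 1) L,
          periodicInteraction W L X * ((‖Ψ.ψ X‖₊ : ℝ≥0∞)) ^ 2) ≤ ENNReal.ofReal (Θ * ((n : ℝ) + 1))) :
    (∫⁻ X in cellN (n + 1) L, periodicInteraction W L X * ((‖Ψ.ψ X‖₊ : ℝ≥0∞)) ^ 2) ≠ ⊤ ∧
      12 * (∫ X in cellN (n + 1) L, kineticDensityReal Ψ.ψ X) +
        2 * (∫⁻ X in cellN (n + 1) L, periodicInteraction W L X * ((‖Ψ.ψ X‖₊ : ℝ≥0∞)) ^ 2).toReal ≤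
          Θ * ((n : ℝ) + 1) := by
  set T := ∫⁻ X in cellN (n + 1) L, kineticDensity Ψ.ψ X with hTdef
  set P := ∫⁻ X in cellN (n + 1) L, periodicInteraction W L X * ((‖Ψ.ψ X‖₊ : ℝ≥0∞)) ^ 2 with hPdef
  have hlt : ENNReal.ofReal 12 * T + ENNReal.ofReal 2 * P < ⊤ := lt_of_le_of_lt h ENNReal.ofReal_lt_top
  have hP : P ≠ ⊤ := by
    intro hP
    rw [hP, ENNReal.mul_top (by norm_num), add_top] at hlt
    exact lt_irrefl _ hlt
  refine ⟨hP, ?_⟩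
  have h2 := ENNReal.toReal_mono ENNReal.ofReal_ne_top h
  rw [ENNReal.toReal_ofReal (by positivity), ENNReal.toReal_add (ENNReal.mul_ne_top ENNReal.ofReal_ne_top hT)
    (ENNReal.mul_ne_top ENNReal.ofReal_ne_top hP), ENNReal.toReal_mul, ENNReal.toReal_mul,
    ENNReal.toReal_ofReal (by norm_num), ENNReal.toReal_ofReal (by norm_num),
    toReal_lintegral_kineticDensity Ψ] at h2
  exact h2

end PairFunctional

/-! ## Admissibility of the test amplitudes `ρ_k u` and `A` -/

section TestAmplitudes

variable (hL : 0 < L) (Ψ : PeriodicTrialState (n + 1) L) (m : Fin 3 → ℤ)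

/-- `X ↦ e_m(x_j)` is `Cⁿ` (all orders; local copy of the plane-wave toolkit). [folklore] -/
private theorem contDiff_cellWave_comp_apply_of_le {N : ℕ} {r : ℕ∞} (L : ℝ) (m : Fin 3 → ℤ) (j : Fin N) :
    ContDiff ℝ r (fun Y : Config N => cellWave L m (Y j)) :=
  ((contDiff_cellWave L m).of_le (by exact_mod_cast le_top)).comp (contDiff_apply ℝ Space j)

/-- The modulated amplitude `ρ_k u` is `C³` for a `C³` state. [folklore] -/
theorem contDiff_rho_mul (hC3 : ContDiff ℝ 3 Ψ.ψ) :
    ContDiff ℝ 3 fun X : Config (n + 1) => (∑ j : Fin (n + 1), cellWave L m (X j)) * (((Ψ.ψ X).re : ℝ) : ℂ) :=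
  (ContDiff.sum fun j _ => contDiff_cellWave_comp_apply_of_le L m j).mul
    (Literature.MathematicalPhysics.QuantumManyBody.BoseGas.contDiff_ofReal_comp (contDiff_three_realAmp Ψ hC3))

include hL in
/-- `ρ_k u` is lattice periodic. [folklore] -/
theorem rho_mul_periodic (X : Config (n + 1)) (i : Fin (n + 1)) (c : Fin 3) :
    (∑ j : Fin (n + 1), cellWave L m ((X + Pi.single i (EuclideanSpace.single c L) : Config (n + 1)) j)) *
        (((Ψ.ψ (X + Pi.single i (EuclideanSpace.single c L))).re : ℝ) : ℂ) =
      (∑ j : Fin (n + 1), cellWave L m (X j)) * (((Ψ.ψ X).re : ℝ) : ℂ) := by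
  rw [Ψ.periodic X i c]
  congr 1
  exact Finset.sum_congr rfl fun j _ => cellWave_comp_apply_periodic hL.ne' m j X i c

/-- `ρ_k u` is Bose symmetric. [folklore] -/
theorem rho_mul_symm (σ : Equiv.Perm (Fin (n + 1))) (X : Config (n + 1)) :
    (∑ j : Fin (n + 1), cellWave L m ((X ∘ σ) j)) * (((Ψ.ψ (X ∘ σ)).re : ℝ) : ℂ) =
      (∑ j : Fin (n + 1), cellWave L m (X j)) * (((Ψ.ψ X).re : ℝ) : ℂ) := by
  rw [Ψ.symm σ X]
  congr 1
  exact Equiv.sum_comp σ (fun j => cellWave L m (X j))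

/-- The amplitude `A = ∑ⱼ eⱼ(κu - 2i∂ⱼu)` is `C²` for a `C³` state. [folklore] -/
theorem contDiff_commAmp (hC3 : ContDiff ℝ 3 Ψ.ψ) (κ : ℂ) (k : Space) :
    ContDiff ℝ 2 fun X : Config (n + 1) => ∑ j : Fin (n + 1), cellWave L m (X j) *
      (κ * (((Ψ.ψ X).re : ℝ) : ℂ) - 2 * Complex.I * ((fderiv ℝ (fun Z => (Ψ.ψ Z).re) X (Pi.single j k) : ℝ) : ℂ)) := by
  have hu := contDiff_three_realAmp Ψ hC3
  refine ContDiff.sum fun j _ => (contDiff_cellWave_comp_apply_of_le L m j).mul ?_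
  exact (contDiff_const.mul (Literature.MathematicalPhysics.QuantumManyBody.BoseGas.contDiff_ofReal_comp (hu.of_le (by norm_num)))).sub
    (contDiff_const.mul (Literature.MathematicalPhysics.QuantumManyBody.BoseGas.contDiff_ofReal_comp (contDiff_two_fderiv_apply_const hu _)))

include hL in
/-- `A` is lattice periodic. [folklore] -/
theorem commAmp_periodic (κ : ℂ) (k : Space) (X : Config (n + 1)) (i : Fin (n + 1)) (c : Fin 3) :
    (∑ j : Fin (n + 1), cellWave L m ((X + Pi.single i (EuclideanSpace.single c L) : Config (n + 1)) j) *
      (κ * (((Ψ.ψ (X + Pi.single i (EuclideanSpace.single c L))).re : ℝ) : ℂ) - 2 * Complex.I *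
        ((fderiv ℝ (fun Z => (Ψ.ψ Z).re) (X + Pi.single i (EuclideanSpace.single c L)) (Pi.single j k) : ℝ) : ℂ))) =
    ∑ j : Fin (n + 1), cellWave L m (X j) *
      (κ * (((Ψ.ψ X).re : ℝ) : ℂ) - 2 * Complex.I * ((fderiv ℝ (fun Z => (Ψ.ψ Z).re) X (Pi.single j k) : ℝ) : ℂ)) := by
  refine Finset.sum_congr rfl fun j _ => ?_
  rw [cellWave_comp_apply_periodic hL.ne' m j X i c, Ψ.periodic X i c,
    fderiv_apply_periodic (f := fun Z => (Ψ.ψ Z).re) (fun Y i' c' => realAmp_periodic Ψ Y i' c')]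

/-- `A` is Bose symmetric (`∂_{xⱼ·k}u(X∘σ) = ∂_{x_{σj}·k}u(X)` and reindexing). [folklore] -/
theorem commAmp_symm (κ : ℂ) (k : Space) (σ : Equiv.Perm (Fin (n + 1))) (X : Config (n + 1)) :
    (∑ j : Fin (n + 1), cellWave L m ((X ∘ σ) j) *
      (κ * (((Ψ.ψ (X ∘ σ)).re : ℝ) : ℂ) - 2 * Complex.I *
        ((fderiv ℝ (fun Z => (Ψ.ψ Z).re) (X ∘ σ) (Pi.single j k) : ℝ) : ℂ))) =
    ∑ j : Fin (n + 1), cellWave L m (X j) *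
      (κ * (((Ψ.ψ X).re : ℝ) : ℂ) - 2 * Complex.I * ((fderiv ℝ (fun Z => (Ψ.ψ Z).re) X (Pi.single j k) : ℝ) : ℂ)) := by
  have hud : Differentiable ℝ fun Z => (Ψ.ψ Z).re := (contDiff_realAmp Ψ).differentiable one_ne_zero
  simp_rw [Ψ.symm σ X, fderiv_comp_perm_apply_single hud σ (realAmp_symm Ψ σ) X]
  exact Equiv.sum_comp σ (fun j => cellWave L m (X j) *
    (κ * (((Ψ.ψ X).re : ℝ) : ℂ) - 2 * Complex.I * ((fderiv ℝ (fun Z => (Ψ.ψ Z).re) X (Pi.single j k) : ℝ) : ℂ)))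

/-- The mass of `ρ_k u` is `(n+1) S_m`: `∫ |ρ_k u|² = ∫ |∑ⱼeⱼ|² |Ψ|²`. [folklore] -/
theorem integral_norm_sq_rho_mul (hreal : ∀ X, Ψ.ψ X = (‖Ψ.ψ X‖ : ℂ)) :
    ∫ X in cellN (n + 1) L, ‖(∑ j : Fin (n + 1), cellWave L m (X j)) * (((Ψ.ψ X).re : ℝ) : ℂ)‖ ^ 2 =
      ∫ X in cellN (n + 1) L, ‖∑ j : Fin (n + 1), cellWave L m (X j)‖ ^ 2 * ‖Ψ.ψ X‖ ^ 2 := by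
  refine integral_congr_ae (ae_of_all _ fun X => ?_)
  simp only [norm_mul, mul_pow]
  rw [← norm_psi_eq Ψ hreal X]

end TestAmplitudes

/-! ## The variational principle for the shifted form -/

/-- **Non-negativity of the shifted form on the Bose class** (variational principle): with
`V = (V^per).toReal` and `E₀ = (E₀^per).toReal < ∞` (finite-range finite continuous profile), every
`C¹` periodic Bose-symmetric `ψ` has `0 ≤ ∫ (|∇ψ|² + (V - E₀)|ψ|²)`. [folklore] -/
theorem shiftedForm_nonneg {v : ℝ → ℝ≥0∞} (hv : IsRepulsiveFiniteRange v) (htop : ∀ r, v r ≠ ⊤)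
    (hcont : Continuous fun x : Space => (v ‖x‖).toReal) (hL : 0 < L)
    (hE : periodicGroundStateEnergy v (n + 1) L ≠ ⊤)
    (hVc : Continuous fun X : Config (n + 1) => (periodicInteraction v L X).toReal)
    (ψ : Config (n + 1) → ℂ) (hψ : ContDiff ℝ 1 ψ)
    (hper : ∀ (X : Config (n + 1)) (i : Fin (n + 1)) (c : Fin 3),
      ψ (X + Pi.single i (EuclideanSpace.single c L)) = ψ X)
    (hsymm : ∀ (σ : Equiv.Perm (Fin (n + 1))) (X : Config (n + 1)), ψ (X ∘ σ) = ψ X) :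
    0 ≤ ∫ X in cellN (n + 1) L, (kineticDensityReal ψ X +
      ((periodicInteraction v L X).toReal - (periodicGroundStateEnergy v (n + 1) L).toReal) * ‖ψ X‖ ^ 2) := by
  obtain ⟨Cw, hCw, hW⟩ := ImuWeakEulerLagrange.exists_periodicInteraction_le hv htop hcont hL (n + 1)
  have h := ImuWeakEulerLagrange.toReal_groundStateEnergy_mul_le hv.1 hCw hW hE hψ hper hsymm
  have i1 : IntegrableOn (fun X => kineticDensityReal ψ X + (periodicInteraction v L X).toReal * ‖ψ X‖ ^ 2)
      (cellN (n + 1) L) :=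
    integrableOn_cellN ((continuous_kineticDensityReal hψ).add (hVc.mul (hψ.continuous.norm.pow 2))) L
  have i2 : IntegrableOn (fun X => (periodicGroundStateEnergy v (n + 1) L).toReal * ‖ψ X‖ ^ 2)
      (cellN (n + 1) L) := integrableOn_cellN (continuous_const.mul (hψ.continuous.norm.pow 2)) L
  have heq : ∀ X, kineticDensityReal ψ X +
      ((periodicInteraction v L X).toReal - (periodicGroundStateEnergy v (n + 1) L).toReal) * ‖ψ X‖ ^ 2 =
      (kineticDensityReal ψ X + (periodicInteraction v L X).toReal * ‖ψ X‖ ^ 2) -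
        (periodicGroundStateEnergy v (n + 1) L).toReal * ‖ψ X‖ ^ 2 := fun X => by ring
  simp_rw [heq]
  rw [integral_sub i1 i2, integral_const_mul]
  linarith

end PuffFeynmanFloor

/-- **Registered sub-goal `puffFeynman_fsum_real`** (supports stmt-AtomisticToContinuum-11785, line
`coupling-slope-pocket`): the f-sum rule in the real form consumed by the Puff–Feynman engine,
`Re ∫ conj(ρ_k u) A = (n+1)‖k‖²` for every real periodic state (`u = Re Ψ`, `k = 2πm/L`,
`A = ∑ⱼ eⱼ(‖k‖²u - 2i∂_{xⱼ·k}u)`). [folklore] -/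
theorem puffFeynman_fsum_real :
    ∀ (n : ℕ) (L : ℝ), 0 < L → ∀ (Ψ : PeriodicTrialState (n + 1) L), (∀ X, Ψ.ψ X = (‖Ψ.ψ X‖ : ℂ)) → ∀ (m : Fin 3 → ℤ), (∫ X in cellN (n + 1) L, starRingEnd ℂ ((∑ j : Fin (n + 1), cellWave L m (X j)) * (((Ψ.ψ X).re : ℝ) : ℂ)) * ∑ j : Fin (n + 1), cellWave L m (X j) * ((((‖(2 * Real.pi / L) • latticeVec 1 m‖ ^ 2 : ℝ) : ℂ)) * (((Ψ.ψ X).re : ℝ) : ℂ) - 2 * Complex.I * ((fderiv ℝ (fun Z => (Ψ.ψ Z).re) X (Pi.single j ((2 * Real.pi / L) • latticeVec 1 m)) : ℝ) : ℂ))).re = ((n : ℝ) + 1) * ‖(2 * Real.pi / L) • latticeVec 1 m‖ ^ 2 :=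
  fun _ _ hL Ψ hreal m => PuffFeynmanFloor.fsum_real hL Ψ hreal m

end Summit.AtomisticToContinuum.BoseEinsteinCondensation.Theorems

end
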